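import Mathlib

/-!
# From cusp-residual to cusp-open-dense: the abstract point-set lemma behind Kaloshin–Zhang's genericity class

CITATION HEADER (lean-in-tree rule 2026-08-18). A PROVED abstract lemma (point-set topology only), isolating the
mechanism by which V. Kaloshin and K. Zhang pass from "dense good amplitudes over a dense set of directions" to an
OPEN AND DENSE set `𝒲` inside the cusp `𝒱(𝒰, ε₀) = {εH₁ : H₁ ∈ 𝒰, 0 < ε < ε₀(H₁)}` of their Theorem 1.2
(*Arnold diffusion for smooth systems of two and a half degrees of freedom*, Ann. of Math. Stud. 208 (2020),
bib key `KaloshinZhang2020`; the construction of a LOWER SEMICONTINUOUS `ε₀` and the remark "this property is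
open due to the smoothness of the flow" are at arXiv:1212.1150v3 `diffusion-scheme.tex` l.711–719, l.725–727,
book §2). Written by the pub-arnold near-miss cell to make the typed content of Kaloshin–Zhang's arXiv-printed
remark on the Cheng / Cheng–Xue genericity class (l.297–306: "ℜ_a residual, while our 𝒰 is open and dense …
Regularity of dependence of … a_P on P is not discussed") ONE NAMED HYPOTHESIS, `(l)` below. Companion of
`Literature.Dynamics.Hamiltonian.KaloshinZhang2020.TheoremShapes` (`KZCuspGeneric` vs `CXCuspResidual`).
Nothing here is specific to Hamiltonian dynamics; all three results are kernel-checked, tagged [folklore].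

Setting: directions `P : X` (a topological space standing for the unit sphere of `Cʳ`), amplitudes `λ : ℝ`, the
pair `(λ, P) : ℝ × X` standing for the perturbation `λ • P` (on `(0, ∞) × sphere` the map `(λ, P) ↦ λ • P` is a
homeomorphism onto the punctured cone, so nothing is lost).
* `cuspSet a = {(λ, P) | 0 < λ ∧ λ < a P}` — KZ's `𝒱(𝒰, ε₀)` / Cheng–Xue's cusp with `a = ε₀` resp. `a_P`.
* `Good` — the set of perturbations with the desired orbit; hypothesis `(o)`: it is open.
* `(r)`: for `P ∈ ℜ` the good amplitudes are dense in `(0, a P)` (Cheng–Xue: `R_P` residual in `[0, a_P]`).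
* `(l)`: near every `P₀`, for every `λ₀ < a P₀`, some `P ∈ ℜ` has `a P > λ₀` — discharged by "`ℜ` dense and `a`
  lower semicontinuous" (`hl_of_dense_of_lsc`), which is what Kaloshin–Zhang arrange; for Cheng–Xue's `a_P`
  no regularity is stated in print.
Conclusion: `Good` is dense in the cusp (and relatively open by `(o)`), i.e. KZ-class genericity.
-/

open Set Filter
open scoped Topology

namespace Literature.Dynamics.Hamiltonian.KaloshinZhang2020


/-- The cusp `𝒱(a) = {(λ, P) : 0 < λ < a(P)}` over a direction space `X` (KZ20 Thm 1.2: `𝒱(𝒰, ε₀)`). [cite: KaloshinZhang2020, Thm 1.2 (scan chunk p0008; unpaginated copy, printed page not held)] -/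
def cuspSet {X : Type*} (a : X → ℝ) : Set (ℝ × X) := {q | 0 < q.1 ∧ q.1 < a q.2}

/-- **L-gen-2.**  Cusp-residual (dense good amplitudes over a set `ℜ` of directions along which the
cusp height `a` is lower-semicontinuous in the sense `(l)`) plus openness of `Good` implies that
`Good` is dense in the cusp: every point of the cusp lies in the closure of `Good ∩ cusp`. [folklore] -/
theorem cusp_dense_of_fibrewise_dense {X : Type*} [TopologicalSpace X]
    (a : X → ℝ) (Good : Set (ℝ × X)) (ℜ : Set X)
    (hr : ∀ P ∈ ℜ, ∀ l₀, 0 < l₀ → l₀ < a P → ∀ η > 0,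
      ∃ l, 0 < l ∧ l < a P ∧ |l - l₀| < η ∧ (l, P) ∈ Good)
    (hl : ∀ P₀ : X, ∀ l₀ : ℝ, l₀ < a P₀ → ∀ U ∈ 𝓝 P₀, ∃ P ∈ ℜ, P ∈ U ∧ l₀ < a P) :
    cuspSet a ⊆ closure (Good ∩ cuspSet a) := by
  rintro ⟨l₀, P₀⟩ ⟨h0, ha⟩
  rw [mem_closure_iff_nhds]
  intro W hW
  -- a product neighbourhood of (l₀, P₀) inside W
  obtain ⟨V, hV, U, hU, hVU⟩ := mem_nhds_prod_iff.mp hW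
  obtain ⟨η, hη, hball⟩ := Metric.mem_nhds_iff.mp hV
  -- a direction P ∈ ℜ ∩ U whose cusp height exceeds l₀
  obtain ⟨P, hPℜ, hPU, hPa⟩ := hl P₀ l₀ ha U hU
  -- a good amplitude l close to l₀ under the height a P
  obtain ⟨l, hl0, hla, hlη, hgood⟩ := hr P hPℜ l₀ h0 hPa η hη
  refine ⟨(l, P), ?_, hgood, hl0, hla⟩
  apply hVU
  refine ⟨?_, hPU⟩
  apply hball
  rw [Metric.mem_ball, Real.dist_eq]
  exact hlη

/-- The open-and-dense form: with `(o)` `Good` open, `Good ∩ cusp` is relatively open in the cusp and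
(by `cusp_dense_of_fibrewise_dense`) dense in it — KZ20's class `𝒲 ⊂ 𝒱(𝒰, ε₀)`. [folklore] -/
theorem cusp_openDense_of_fibrewise_dense {X : Type*} [TopologicalSpace X]
    (a : X → ℝ) (Good : Set (ℝ × X)) (ℜ : Set X) (ho : IsOpen Good)
    (hr : ∀ P ∈ ℜ, ∀ l₀, 0 < l₀ → l₀ < a P → ∀ η > 0,
      ∃ l, 0 < l ∧ l < a P ∧ |l - l₀| < η ∧ (l, P) ∈ Good)
    (hl : ∀ P₀ : X, ∀ l₀ : ℝ, l₀ < a P₀ → ∀ U ∈ 𝓝 P₀, ∃ P ∈ ℜ, P ∈ U ∧ l₀ < a P) :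
    (∃ O : Set (ℝ × X), IsOpen O ∧ Good ∩ cuspSet a = O ∩ cuspSet a) ∧
      cuspSet a ⊆ closure (Good ∩ cuspSet a) :=
  ⟨⟨Good, ho, rfl⟩, cusp_dense_of_fibrewise_dense a Good ℜ hr hl⟩

/-- Hypothesis `(l)` follows from: `ℜ` dense and `a` lower semicontinuous.  (So KZ's construction of a
lower semicontinuous `ε₀`, arXiv `diffusion-scheme.tex` l.711–719, is exactly what discharges it.) [folklore] -/
theorem hl_of_dense_of_lsc {X : Type*} [TopologicalSpace X]
    (a : X → ℝ) (ℜ : Set X) (hd : Dense ℜ) (hlsc : LowerSemicontinuous a) :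
    ∀ P₀ : X, ∀ l₀ : ℝ, l₀ < a P₀ → ∀ U ∈ 𝓝 P₀, ∃ P ∈ ℜ, P ∈ U ∧ l₀ < a P := by
  intro P₀ l₀ hlt U hU
  have h1 : ∀ᶠ P in 𝓝 P₀, l₀ < a P := hlsc P₀ l₀ hlt
  have h2 : {P | l₀ < a P} ∩ U ∈ 𝓝 P₀ := inter_mem h1 hU
  obtain ⟨O, hOsub, hOopen, hP₀O⟩ := mem_nhds_iff.mp h2
  obtain ⟨P, hPO, hPℜ⟩ := hd.inter_open_nonempty O hOopen ⟨P₀, hP₀O⟩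
  exact ⟨P, hPℜ, (hOsub hPO).2, (hOsub hPO).1⟩

end Literature.Dynamics.Hamiltonian.KaloshinZhang2020
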